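import Mathlib

/-!
# Defect certificate for `QuarticGate` (line `recession-cone`) — polynomial calculus

Algebraic lemmas on multivariate polynomials used by stub S3 (`stub_defectCertificate`):

* the chain rule for a derivation applied to `MvPolynomial.aeval` (in particular for
  `Polynomial.derivative ∘ MvPolynomial.aeval` along a line);
* the first-order Taylor coefficient: if `t ↦ P(c + t d)` vanishes identically then
  `Σᵢ dᵢ ∂ᵢP(c) = 0`;
* linear substitutions `bind₁ (j ↦ Σᵢ C (G j i) · Xᵢ)` preserve homogeneity (evaluation and the
  chain rule for them are in `…Theorems.MomentParityQuarticGateTransport` / `…QuadRange`);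
* a growth bound for homogeneous polynomials on a box.
-/

namespace Summit.AnomalousDissipation.AnomalousDissipation.Theorems.MomentParityQuarticGate

open MvPolynomial

set_option linter.dupNamespace false

/-- **Chain rule for derivations on polynomial substitutions.** For a derivation `D` of a
commutative algebra `A` and a substitution `L : σ → A`,
`D (aeval L P) = Σᵢ aeval L (∂ᵢP) • D (L i)`. [folklore] -/
theorem derivation_aeval_eq_sum {σ R A M : Type*} [Fintype σ] [CommRing R] [CommRing A]
    [Algebra R A] [AddCommGroup M] [Module A M] [Module R M] [IsScalarTower R A M]
    (D : Derivation R A M) (L : σ → A) (P : MvPolynomial σ R) :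
    D (aeval L P) = ∑ i, aeval L (pderiv i P) • D (L i) := by
  classical
  induction P using MvPolynomial.induction_on with
  | C r => simp
  | add p q hp hq => simp [map_add, hp, hq, add_smul, Finset.sum_add_distrib]
  | mul_X p j hp =>
    rw [map_mul, aeval_X, Derivation.leibniz, hp, Finset.smul_sum]
    have h1 : ∀ i, aeval L (pderiv i (p * X j)) • D (L i) =
        (L j * aeval L (pderiv i p)) • D (L i) + (if i = j then aeval L p • D (L j) else 0) := by
      intro i
      rw [pderiv_mul, pderiv_X, map_add, map_mul, map_mul, aeval_X, add_smul, mul_comm]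
      congr 1
      by_cases hij : i = j
      · subst hij
        simp
      · simp [hij]
    simp_rw [h1, Finset.sum_add_distrib, Finset.sum_ite_eq', Finset.mem_univ, if_true, smul_smul]
    rw [add_comm]

/-- **Derivative of a polynomial along a line**: for `L i = C cᵢ + C dᵢ · X`,
`(aeval L P)' = Σᵢ aeval L (∂ᵢP) · C dᵢ`. [folklore] -/
theorem derivative_aeval_line {σ : Type*} [Fintype σ] (c d : σ → ℝ) (P : MvPolynomial σ ℝ) :
    Polynomial.derivative
        (aeval (fun i => Polynomial.C (c i) + Polynomial.C (d i) * Polynomial.X) P) =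
      ∑ i, aeval (fun i => Polynomial.C (c i) + Polynomial.C (d i) * Polynomial.X) (pderiv i P) *
        Polynomial.C (d i) := by
  have h := derivation_aeval_eq_sum Polynomial.derivative'
    (fun i => Polynomial.C (c i) + Polynomial.C (d i) * Polynomial.X) P
  simp only [Polynomial.derivative'_apply, smul_eq_mul] at h
  rw [h]
  refine Finset.sum_congr rfl fun i _ => ?_
  simp

/-- Evaluating `aeval (C c + C d · X) P` at `t` gives `P(c + t d)`. [folklore] -/
theorem eval_aeval_line {σ : Type*} [Fintype σ] (c d : σ → ℝ) (P : MvPolynomial σ ℝ) (t : ℝ) :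
    Polynomial.eval t (aeval (fun i => Polynomial.C (c i) + Polynomial.C (d i) * Polynomial.X) P) =
      eval (fun i => c i + t * d i) P := by
  have h := comp_aeval_apply (fun i => Polynomial.C (c i) + Polynomial.C (d i) * Polynomial.X)
    (Polynomial.aeval t) P
  rw [Polynomial.coe_aeval_eq_eval] at h
  have hL : (fun i => Polynomial.eval t (Polynomial.C (c i) + Polynomial.C (d i) * Polynomial.X)) =
      fun i => c i + t * d i := funext fun i => by
    rw [Polynomial.eval_add, Polynomial.eval_C, Polynomial.eval_mul, Polynomial.eval_C,
      Polynomial.eval_X, mul_comm]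
  rw [h, hL, ← aeval_eq_eval]

/-- **First-order Taylor coefficient.** If the one-variable polynomial `t ↦ P(c + t d)` vanishes
identically on `ℝ`, then its linear coefficient `Σᵢ dᵢ ∂ᵢP(c)` vanishes. [folklore] -/
theorem sum_mul_eval_pderiv_eq_zero :
    ∀ {σ : Type} [Fintype σ] (c d : σ → ℝ) (P : MvPolynomial σ ℝ),
      (∀ t : ℝ, MvPolynomial.eval (fun i => c i + t * d i) P = 0) →
      ∑ i, d i * MvPolynomial.eval c (MvPolynomial.pderiv i P) = 0 := by
  intro σ _ c d P h
  set R : Polynomial ℝ :=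
    aeval (fun i => Polynomial.C (c i) + Polynomial.C (d i) * Polynomial.X) P with hR
  have hR0 : R = 0 := Polynomial.funext fun t => by
    rw [hR, eval_aeval_line, h t, Polynomial.eval_zero]
  have hder : Polynomial.eval 0 (Polynomial.derivative R) = 0 := by
    rw [hR0, Polynomial.derivative_zero, Polynomial.eval_zero]
  rw [hR, derivative_aeval_line, Polynomial.eval_finsetSum] at hder
  rw [← hder]
  refine Finset.sum_congr rfl fun i _ => ?_
  rw [Polynomial.eval_mul, Polynomial.eval_C, eval_aeval_line, mul_comm]
  simp

/-- A linear substitution of a homogeneous polynomial of degree `n` is homogeneous of degree `n`.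
[folklore] -/
theorem isHomogeneous_bind₁_linear {σ τ : Type*} [Fintype τ] (G : σ → τ → ℝ) {P : MvPolynomial σ ℝ}
    {n : ℕ} (hP : P.IsHomogeneous n) :
    (bind₁ (fun j => ∑ i, C (G j i) * (X i : MvPolynomial τ ℝ)) P).IsHomogeneous n := by
  have h := hP.aeval (fun j => ∑ i, C (G j i) * (X i : MvPolynomial τ ℝ)) (n := 1) fun j =>
    IsHomogeneous.sum _ _ _ fun i _ => (isHomogeneous_X ℝ i).C_mul _
  rw [aeval_eq_bind₁, one_mul] at h
  exact h

/-- **Growth of a homogeneous polynomial on a box**: if `|xᵢ| ≤ R` for all `i` then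
`|Q(x)| ≤ (Σ_{α ∈ supp Q} |coeff α Q|) · R ^ k` for `Q` homogeneous of degree `k`. [folklore] -/
theorem abs_eval_le_of_isHomogeneous {σ : Type*} [Fintype σ] {Q : MvPolynomial σ ℝ} {k : ℕ}
    (hQ : Q.IsHomogeneous k) {R : ℝ} {x : σ → ℝ} (hx : ∀ i, |x i| ≤ R) :
    |eval x Q| ≤ (∑ α ∈ Q.support, |coeff α Q|) * R ^ k := by
  rw [eval_eq', Finset.sum_mul]
  refine (Finset.abs_sum_le_sum_abs _ _).trans (Finset.sum_le_sum fun α hα => ?_)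
  rw [abs_mul]
  refine mul_le_mul_of_nonneg_left ?_ (abs_nonneg _)
  have hdeg : ∑ i, α i = k := by
    rw [hQ.degree_eq_sum_deg_support hα, ← Finsupp.degree_apply, Finsupp.degree_eq_sum]
  rw [Finset.abs_prod, ← hdeg, ← Finset.prod_pow_eq_pow_sum]
  refine Finset.prod_le_prod (fun i _ => abs_nonneg (x i ^ α i)) fun i _ => ?_
  rw [abs_pow]
  exact pow_le_pow_left₀ (abs_nonneg _) (hx i) _

end Summit.AnomalousDissipation.AnomalousDissipation.Theorems.MomentParityQuarticGate
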